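import Summits.ResolutionOfSingularities.ResolutionOfSingularities.Theorems.PurelyInseparableDim4ChartAtlasSNCFarRepairW
import HarnessLib

/-!
# Purely inseparable four-folds `z^p + F(x₁, …, x₄)`: THE FAR SIDE OF S3-N2 ON `W`, UNCONDITIONAL FORM (index-keyed near/far boundary of
# p704073) — EITHER the escaping global centre is snc with the transformed boundary OR one extra blow-up along the far-resonance loci repairs it
# (cell `res-dim4-pi`, typ-2 g7; the collision heights are COMPUTED from the data)

[OURS · counted 0] (D-0157 DOOR 2; DR-157-C.) The index-keyed twin of `…SNCFarSideWPairs`: setting of p704073 (`π : W → 𝔸⁵` ANY blowing up along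
`V(z, x_S)`, chart `j ∈ S`, `b_j = 0`, `Θⱼ` of record, `F ≠ 0` clean `S`-permissible, `F₁` `S'`-permissible, `j ∉ S'`, `S' ≠ ∅`, near `ms/c`, far
`fs/d`, `|B_near| ≤ 1`). PROVED here (no `sorry`, no new axiom):

* **`farSide_globalCentre`** — WITHOUT ANY HEIGHT HYPOTHESIS there is a nodup list `hs` of non-zero collision heights with: `hs = [] →`
  `HasSNCWith M′.boundary Zc` (p704073); `hs ≠ [] →` the stage repair centre `C_W = 𝓘(closure φⱼ V(C(hs)))` is admissible for `M′` (p719757) and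
  after EVERY blowing up of `W` along it `St(Zc)` is REGULAR, inside the support, snc with the transformed boundary (p720339).

Nothing here is a statement about resolution of singularities in dimension ≥ 4 / characteristic `p` (NOT proved anywhere in this programme).
bears_on: LADDER-RESOLUTION:D157-DOOR2 (res-dim4-pi). Supports stmt-ResolutionOfSingularities-16155 (helper).
-/

-- every declaration of this summit lives under `Summit.ResolutionOfSingularities.ResolutionOfSingularities`
-- (summit = problem), which the duplicate-namespace linter flags; house convention (cf. the Target file).
set_option linter.dupNamespace false

noncomputable section

open MvPolynomial CategoryTheory AlgebraicGeometry Opposite TopologicalSpace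
open AlgebraicGeometry.Scheme.IdealSheafData (ofIdealTop vanishingIdeal)

namespace Summit.ResolutionOfSingularities.ResolutionOfSingularities.Theorems.PIDim4

open Literature.AlgebraicGeometry.Resolution
open Literature.AlgebraicGeometry.Resolution.Hauser2010
open Literature.AlgebraicGeometry.Resolution.AffinePointBlowup (P A γ coord Wtop ξ)
open Literature.Barriers.ResolutionOfSingularities

namespace ChartDictionary

variable {K : Type} [Field K] {p : ℕ} [hp : Fact p.Prime] [CharP K p]
  {S S' : Finset (Fin 4)} {j : Fin 4} {b : Fin 4 → K} {Θⱼ : A 4 K ≃ₐ[K] A 4 K} {h : MvPolynomial (Fin 4) K}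
  {F F₁ : MvPolynomial (Fin 4) K} {W : Scheme.{0}} {π : W ⟶ P 4 K}

/-- **THE FAR SIDE OF S3-N2 ON `W`, UNCONDITIONAL FORM** (index-keyed near/far boundary, escaping case `j ∉ S'`, `S' ≠ ∅`, `|B_near| ≤ 1`). -/
theorem farSide_globalCentre [IsAlgClosed K] (hj : j ∈ S) (hjS' : j ∉ S') (hbj : b j = 0) (hF : F ≠ 0)
    (hclean : HauserPerlega.IsClean p F) (h0j : Θⱼ (X 0) = X 0 + rename Fin.succ h) (hsj : ∀ i : Fin 4, Θⱼ (X i.succ) = X i.succ + C (b i))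
    (hπ : IsBlowup π (AffineCoordBlowup.𝓘Λ 4 K (insert 0 (Fin.succ '' (S : Set (Fin 4))))))
    (hperm : (p : ℕ∞) ≤ CentreBlowup.ordAlong S F)
    (hread : Θⱼ (coordBlowupSubst K (insert 0 (Fin.succ '' (S : Set (Fin 4)))) j.succ (hyp p F)) = X j.succ ^ p * hyp p F₁)
    (hperm' : (p : ℕ∞) ≤ CentreBlowup.ordAlong S' F₁) (ms fs : List (Fin 4)) (c d : Fin 4 → K) (hc : ∀ i ∈ S, c i = 0)
    (hfs : ∀ i ∈ fs, i ∈ S ∧ d i ≠ 0) (hdis : ∀ i ∈ fs, i ∉ ms)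
    (hB1 : j ∈ ms → ∀ m ∈ ms, m ∈ S → m ∈ S' → b m = 0)
    (hB2 : ∀ m ∈ ms, ∀ m' ∈ ms, m ∈ S → m' ∈ S → m ∈ S' → m' ∈ S' → b m ≠ 0 → b m' ≠ 0 → m = m')
    {k₀ : Fin 4} (hk₀ : k₀ ∈ S') :
    haveI : IsIso (CommRingCat.ofHom (Θⱼ : A 4 K →+* A 4 K)) := (inferInstance : IsIso Θⱼ.toRingEquiv.toCommRingCatIso.hom)
    let φⱼ := Spec.map (CommRingCat.ofHom (Θⱼ : A 4 K →+* A 4 K)) ≫ AffineCoordBlowup.chartImm hπ (succ_mem_centreVars hj)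
    let Zc := vanishingIdeal (closureImage φⱼ ((AffineCoordBlowup.𝓘Λ 4 K (insert 0 (Fin.succ '' (S' : Set (Fin 4))))).support : Set (P 4 K)))
    let M' := ((⟨hypSheaf p F, (ms.map fun i => ofIdealTop (Ideal.span {(γ 4 K).symm (X i.succ + C (c i))})) ++
        fs.map fun i => ofIdealTop (Ideal.span {(γ 4 K).symm (X i.succ + C (d i))}), p⟩ :
        MarkedIdeal (P 4 K)).transform π (AffineCoordBlowup.𝓘Λ 4 K (insert 0 (Fin.succ '' (S : Set (Fin 4))))))
    ∃ hs : List K, hs.Nodup ∧ (∀ h' ∈ hs, h' ≠ 0) ∧ (hs = [] → HasSNCWith M'.boundary Zc) ∧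
      (hs ≠ [] →
        let Cmod := (hs.map fun h' => (AffineCoordBlowup.𝓘Λ 4 K (insert 0 (Fin.succ '' ((insert j S' : Finset (Fin 4)) : Set (Fin 4))))).comap
          (Spec.map (CommRingCat.ofHom ((AffinePointBlowup.translateEquiv (n := 4) (Pi.single j.succ (-h')) : A 4 K ≃ₐ[K] A 4 K) :
            A 4 K →+* A 4 K)))).prod
        let CW := vanishingIdeal (closureImage φⱼ (Cmod.support : Set (P 4 K)))
        (CW.comap φⱼ = Cmod ∧ (CW.support : Set W) ⊆ Set.range φⱼ ∧ (CW.support : Set W) ⊆ Zc.support ∧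
            (CW.support : Set W) ⊆ M'.support ∧ Scheme.IsRegular CW.subscheme ∧ HasSNCWith M'.boundary CW) ∧
          ∀ ⦃W'' : Scheme.{0}⦄ ⦃τ : W'' ⟶ W⦄, IsBlowup τ CW →
            Scheme.IsRegular (strictTransformIdeal τ CW Zc).subscheme ∧
              ((strictTransformIdeal τ CW Zc).support : Set W'') ⊆ (M'.transform τ CW).support ∧
              HasSNCWith (M'.transform τ CW).boundary (strictTransformIdeal τ CW Zc)) := by
  intro φⱼ Zc M'
  classical
  -- the active far indices, their heights, and the COLLISION heights
  let act : Finset (Fin 4) := fs.toFinset.filter fun i => i ∈ S' ∧ b i ≠ 0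
  let ht : Fin 4 → K := fun i => -d i / b i
  let coll : Finset K := (act.image ht).filter fun h' =>
    (∃ i ∈ act, ∃ k ∈ act, i ≠ k ∧ ht i = h' ∧ ht k = h') ∨ (j ∈ fs ∧ -d j = h' ∧ ∃ i ∈ act, ht i = h')
  have hact : ∀ i, i ∈ act ↔ i ∈ fs ∧ i ∈ S' ∧ b i ≠ 0 := fun i => by
    simp only [act, Finset.mem_filter, List.mem_toFinset]
  have hroot : ∀ i : Fin 4, b i ≠ 0 → d i + b i * ht i = 0 := fun i hb => by
    simp only [ht]
    field_simp
    ring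
  have h0 : ∀ h' ∈ coll.toList, h' ≠ 0 := by
    intro h' hh'
    rw [Finset.mem_toList] at hh'
    obtain ⟨hh'img, -⟩ := Finset.mem_filter.mp hh'
    obtain ⟨i, hi, rfl⟩ := Finset.mem_image.mp hh'img
    obtain ⟨hifs, -, hb⟩ := (hact i).mp hi
    exact div_ne_zero (neg_ne_zero.mpr (hfs i hifs).2) hb
  -- off the collision heights the height hypotheses of p704073 hold
  have hH1 : ∀ i ∈ fs, i ∈ S' → b i ≠ 0 → j ∈ fs → (∀ h' ∈ coll.toList, d j + h' ≠ 0) → (∀ h' ∈ coll.toList, d i + b i * h' ≠ 0) →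
      d i ≠ b i * d j := by
    intro i hi hiS' hb hjfs hch _ heq
    have hia : i ∈ act := (hact i).mpr ⟨hi, hiS', hb⟩
    have hh : ht i = -d j := by
      simp only [ht]
      rw [heq, neg_div, mul_div_cancel_left₀ _ hb]
    have hmem : -d j ∈ coll :=
      Finset.mem_filter.mpr ⟨Finset.mem_image.mpr ⟨i, hia, hh⟩, Or.inr ⟨hjfs, rfl, i, hia, hh⟩⟩
    exact hch (-d j) (Finset.mem_toList.mpr hmem) (add_neg_cancel (d j))
  have hH2 : ∀ i ∈ fs, ∀ k ∈ fs, i ≠ k → i ∈ S' → k ∈ S' → b i ≠ 0 → b k ≠ 0 → (∀ h' ∈ coll.toList, d i + b i * h' ≠ 0) →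
      (∀ h' ∈ coll.toList, d k + b k * h' ≠ 0) → d i * b k ≠ d k * b i := by
    intro i hi k hk hik hiS' hkS' hb hb' hich _ heq
    have hia : i ∈ act := (hact i).mpr ⟨hi, hiS', hb⟩
    have hka : k ∈ act := (hact k).mpr ⟨hk, hkS', hb'⟩
    have hh : ht i = ht k := by
      simp only [ht]
      rw [div_eq_div_iff hb hb', neg_mul, neg_mul, heq]
    have hmem : ht i ∈ coll :=
      Finset.mem_filter.mpr ⟨Finset.mem_image.mpr ⟨i, hia, rfl⟩, Or.inl ⟨i, hia, k, hka, hik, rfl, hh.symm⟩⟩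
    exact hich (ht i) (Finset.mem_toList.mpr hmem) (hroot i hb)
  refine ⟨coll.toList, Finset.nodup_toList _, h0, fun hnil => ?_, fun hne => ⟨?_, ?_⟩⟩
  · -- no collision: p704073
    exact hasSNCWith_transform_boundary_globalCentre_of_far_heights hj hjS' hbj hF hclean h0j hsj hπ hperm hread hperm' ms fs c d hc hfs hdis hB1
      hB2 (fun i hi hiS' hb hjfs => hH1 i hi hiS' hb hjfs (fun h' hh' => by rw [hnil] at hh'; simp at hh')
        fun h' hh' => by rw [hnil] at hh'; simp at hh')
      fun i hi k hk hik hiS' hkS' hb hb' => hH2 i hi k hk hik hiS' hkS' hb hb' (fun h' hh' => by rw [hnil] at hh'; simp at hh')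
        fun h' hh' => by rw [hnil] at hh'; simp at hh'
  · -- the repair centre is admissible
    exact farRepairCentre_package hj hjS' hbj h0j hsj hπ hperm hread hperm' ms fs c d hc hfs hdis coll.toList hne (Finset.nodup_toList _) h0
  · -- after the repair
    exact admissible_strictTransform_after_farRepairW hj hjS' hbj hF hclean h0j hsj hπ hperm hread hperm' ms fs c d hc hfs hdis hB1 hB2
      coll.toList hne (Finset.nodup_toList _) h0 hH1 hH2 hk₀

end ChartDictionary

end Summit.ResolutionOfSingularities.ResolutionOfSingularities.Theorems.PIDim4

end
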